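import Summits.ValiantsHypothesis.ValiantsHypothesis.Theorems.BarrierLeverChowBenchmarkPairsBlockPeelLadder

/-!
# Route BarrierLever — item 22038 `ChowBenchmarkPairs`, line `moore-peel`: the BLOCK PEEL — tilings by an arbitrary CUT predicate
# («good covers»), generalising the P′ tiling of `…BlockPeelRuns` / `…BlockPeelLadder`

Helper file (`--supports stmt-ValiantsHypothesis-22038`; cell valiant-natproofs, rung V4, 𝒟-side benchmark of record, line `moore_peel`;
seat val-np-p4 gen 30).  Closes NO item; definition-free; kernel only.

WHY.  `kernelPoisedAt_of_blocks` (`…BlockPeel`, p706993) accepts ANY cut points `1 = a 0 < ⋯ < a m = h + 1` with good blocks; the arrows of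
record (`segmentMeanValue_of_conjB3`, `…_of_conjPrefix`, `conjPrefixUpTo_of_isolated`) fix particular tilings.  Certificates are cheapest
for SMALL blocks, and the smallest good block through a run of bad stages need not be the P′ block: at the 2-run `1460–61` the P′ block
`{1459,1460,1461}` is `4 380²` (beyond the gate's budget) while the EXACT-RUN double `{1460,1461}` is `2 921²` and nonsingular.  This file states
the tiling theorem for an arbitrary decidable CUT predicate:

* **`kernelPoisedAt_factorial_of_cutPred`**: let `P : ℕ → Prop` be decidable with `P 1`; if every pair of CONSECUTIVE cuts `c < c'` in
  `[1, h+1]` (`P c`, `P c' ∨ c' = h+1`, no `P` strictly between) spans a good block `det J^{!}(c, c'-c)(Λ) ≠ 0`, then `KernelPoisedAt k! h`;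
  `segmentMeanValueAt_of_cutPred` — node #1's statement VERBATIM under the same hypotheses.
Typical use: `P c := c ∉ I` for the list `I` of interior stages of the chosen special blocks; singles between cuts are good stages of
THEOREM W, the rest are the certified blocks.

WHAT THIS IS NOT: no block is certified here; node #1 (∀ h) untouched; nothing on crux stmt-ValiantsHypothesis-14610 or on `VP` versus `VNP`.
-/

set_option linter.dupNamespace false

namespace Summit.ValiantsHypothesis.ValiantsHypothesis.Theorems.BarrierLever.MoorePeel

open Finset

/-- **TILING BY A CUT PREDICATE.**  `P` decidable, `P 1`; every pair of consecutive cuts spans a good block ⇒ `KernelPoisedAt k! h`. -/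
theorem kernelPoisedAt_factorial_of_cutPred (h : ℕ) (P : ℕ → Prop) [DecidablePred P] (hP1 : P 1)
    (hblk : ∀ c c' : ℕ, 1 ≤ c → c < c' → c' ≤ h + 1 → P c → (P c' ∨ c' = h + 1) → (∀ x, c < x → x < c' → ¬ P x) →
      (blockMatrix Nat.factorial c (c' - c)
        (fun s : Fin (c' - c) => (MvPolynomial.X s : MvPolynomial (Fin (c' - c)) ℤ))).det ≠ 0) :
    KernelPoisedAt Nat.factorial h := by
  classical
  -- the cut points: `P`-stages of `[1, h]`, and `h + 1`
  set S : Finset ℕ := (Finset.range (h + 2)).filter (fun c => (1 ≤ c ∧ c ≤ h ∧ P c) ∨ c = h + 1) with hS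
  have hmemS : ∀ c, c ∈ S ↔ (1 ≤ c ∧ c ≤ h ∧ P c) ∨ c = h + 1 := by
    intro c
    rw [hS, Finset.mem_filter, Finset.mem_range]
    constructor
    · exact fun hc => hc.2
    · intro hc
      refine ⟨?_, hc⟩
      rcases hc with hc | hc <;> omega
  have htop : h + 1 ∈ S := (hmemS _).mpr (Or.inr rfl)
  have hone : 1 ∈ S := by
    rcases Nat.eq_zero_or_pos h with hz | hpos
    · exact (hmemS _).mpr (Or.inr (by omega))
    · exact (hmemS _).mpr (Or.inl ⟨le_rfl, hpos, hP1⟩)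
  have hge1 : ∀ c ∈ S, 1 ≤ c := fun c hc => by
    rcases (hmemS c).mp hc with hc | hc <;> omega
  have hle : ∀ c ∈ S, c ≤ h + 1 := fun c hc => by
    rcases (hmemS c).mp hc with hc | hc <;> omega
  set k := S.card with hk
  have hkpos : 0 < k := Finset.card_pos.mpr ⟨1, hone⟩
  set emb := S.orderEmbOfFin hk.symm with hemb
  set a : ℕ → ℕ := fun q => if hq : q < k then emb ⟨q, hq⟩ else h + 1 with ha
  have ha_of_lt : ∀ q (hq : q < k), a q = emb ⟨q, hq⟩ := fun q hq => by simp only [ha, dif_pos hq]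
  have hsurj : ∀ x ∈ S, ∃ j : Fin k, emb j = x := by
    intro x hx
    have : x ∈ Set.range emb := by rw [hemb, Finset.range_orderEmbOfFin]; exact hx
    exact this
  have hmono : ∀ q, q + 1 < k → a q < a (q + 1) := by
    intro q hq
    rw [ha_of_lt q (by omega), ha_of_lt (q + 1) hq]
    exact emb.strictMono (Fin.mk_lt_mk.mpr (Nat.lt_succ_self q))
  have hmem_a : ∀ q (hq : q < k), a q ∈ S := fun q hq => by
    rw [ha_of_lt q hq]
    exact Finset.orderEmbOfFin_mem S hk.symm _
  have hgap : ∀ q (hq : q + 1 < k) (x : ℕ), a q < x → x < a (q + 1) → x ∉ S := by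
    intro q hq x h1 h2 hx
    obtain ⟨j, hj⟩ := hsurj x hx
    rw [ha_of_lt q (by omega)] at h1
    rw [ha_of_lt (q + 1) hq] at h2
    rw [← hj] at h1 h2
    have h1' := emb.lt_iff_lt.mp h1
    have h2' := emb.lt_iff_lt.mp h2
    rw [Fin.lt_def] at h1' h2'
    simp only at h1' h2'
    omega
  refine kernelPoisedAt_of_blocks Nat.factorial (fun k => Nat.factorial_ne_zero k) h (k - 1) a ?_ ?_ ?_ ?_
  · rw [ha_of_lt 0 hkpos]
    show emb ⟨0, hkpos⟩ = 1
    rw [hemb, Finset.orderEmbOfFin_zero hk.symm hkpos]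
    exact le_antisymm (Finset.min'_le S 1 hone) (Finset.le_min' _ _ _ fun c hc => hge1 c hc)
  · rw [ha_of_lt (k - 1) (by omega)]
    have e : (⟨k - 1, by omega⟩ : Fin k) = ⟨k - 1, Nat.sub_lt hkpos (Nat.succ_pos 0)⟩ := rfl
    rw [e, hemb, Finset.orderEmbOfFin_last hk.symm hkpos]
    exact le_antisymm (Finset.max'_le _ _ _ fun c hc => hle c hc) (Finset.le_max' S (h + 1) htop)
  · intro q hq
    exact hmono q (by omega)
  · intro q hq
    have hq1 : q + 1 < k := by omega
    have hlt := hmono q hq1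
    have hcS := hmem_a q (by omega)
    have hc'S := hmem_a (q + 1) hq1
    have hc'le : a (q + 1) ≤ h + 1 := hle _ hc'S
    have hgood : 1 ≤ a q ∧ a q ≤ h ∧ P (a q) := by
      rcases (hmemS _).mp hcS with hc | hc
      · exact hc
      · exfalso; omega
    have hc' : P (a (q + 1)) ∨ a (q + 1) = h + 1 := by
      rcases (hmemS _).mp hc'S with hc | hc
      · exact Or.inl hc.2.2
      · exact Or.inr hc
    exact hblk (a q) (a (q + 1)) hgood.1 hlt hc'le hgood.2.2 hc' fun x hx1 hx2 hPx =>
      hgap q hq1 x hx1 hx2 ((hmemS x).mpr (Or.inl ⟨by omega, by omega, hPx⟩))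

/-- **Node #1 VERBATIM from a cut-predicate tiling.** -/
theorem segmentMeanValueAt_of_cutPred (h : ℕ) (P : ℕ → Prop) [DecidablePred P] (hP1 : P 1)
    (hblk : ∀ c c' : ℕ, 1 ≤ c → c < c' → c' ≤ h + 1 → P c → (P c' ∨ c' = h + 1) → (∀ x, c < x → x < c' → ¬ P x) →
      (blockMatrix Nat.factorial c (c' - c)
        (fun s : Fin (c' - c) => (MvPolynomial.X s : MvPolynomial (Fin (c' - c)) ℤ))).det ≠ 0) :
    ∀ (r : ℕ) (u : Fin r → Finset (Fin h)), Function.Injective u → (∀ i, (u i).card ≤ 2) →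
      (∀ S : Finset (Fin h), S.card ≤ 2 → ∃ i, u i = S) →
      ∃ P : Fin h → Fin h → ℂ,
        (Matrix.of fun i j : Fin r =>
          ∑ g : (↥(benchCols h r j) → ↥(u i)), (∏ c : ↥(benchCols h r j), P (g c) c) *
            ∏ a : ↥(u i),
              ((Finset.univ.filter fun c : ↥(benchCols h r j) => g c = a).card.factorial : ℂ)).det ≠ 0 :=
  kernelPoisedAt_factorial_of_cutPred h P hP1 hblk

end Summit.ValiantsHypothesis.ValiantsHypothesis.Theorems.BarrierLever.MoorePeel
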